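import Literature.AlgebraicGeometry.Resolution.KangarooAtlasCert

/-!
# Kernel-checked rows: a MONOMIAL residual with prescribed exceptional history kangaroos (`q = p²`)

Companion to `KangarooAtlasCert` (same computable model, same conventions quoted from
[cite: Hauser2010, §F–§G]). The atlas' binomial/toric family `x^q + y^b z^c` shows no shade increase
on its swept ranges (PATTERNS C3a). These rows certify that this is NOT a consequence of the monomial
shape alone: with a PRESCRIBED exceptional history the residual `y⁶z²` over `𝔽₂` with `q = 4`,
`r = (6, 1)` (shade `1`) has, at the translated point `z = 1` of the chart `y`, the residual
`y⁴z²` with `r = (4, 0)` and shade `2` — an increase within Moh's bound `+p^(e−1) = +2`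
[cite: Moh1987, Stability Theorem]; likewise `y¹⁵z³` over `𝔽₃`, `q = 9`, `r = (15, 1)`: `2 → 3`.
Hand derivation (atlas NOTES, gen 3): chart `y` at `z = 1` gives `y^{b+c−q}(z+1)^c`; when
`q ∣ b + c − q` the cleaning removes the `q`-th-power monomials and the new shade is `p^{v_p(c)}`
(Lucas), which exceeds the old shade `b + c − r_y − r_z` whenever the prescribed `r` is close to
`(b, c)`. Both Python engines of the atlas print the same values (`zoo-g3` rows). With `r = (6, 0)`
(second row) the same residual does not increase (shades `2 → 2`): the increase is a history effect.

This is a CERTIFICATE of finitely many computations, not a theorem about resolution.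
-/

namespace Literature.AlgebraicGeometry.Resolution.KangarooAtlasCert

/-- `x⁴ + y⁶z²` over `𝔽₂`, prescribed `r = (6, 1)`; chart `y`, point `z = 1`: shades `1, 2`. [cite: Hauser2010, §G] -/
theorem binomial_p2e2_prescribed_kangaroo :
    shades 2 4 ⟨[([6, 2], 1)], [6, 1]⟩ [(0, [0, 1])] = [some 1, some 2] := by decide

/-- the kangaroo state reached there: residual `y⁴z²`, `r = (4, 0)`. [cite: Hauser2010, §G] -/
theorem binomial_p2e2_kangaroo_state :
    step 2 4 ⟨[([6, 2], 1)], [6, 1]⟩ 0 [0, 1] = some ⟨[([4, 2], 1)], [4, 0]⟩ := by decide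

/-- Moh's bound at that increase: `2 ≤ 1 + p^(e−1) = 1 + 2`. [cite: Moh1987, Stability Theorem] -/
theorem binomial_p2e2_moh :
    shade ⟨[([4, 2], 1)], [4, 0]⟩ ≤ shade ⟨[([6, 2], 1)], [6, 1]⟩ + 2 := by decide

/-- control: the same residual with `r = (6, 0)` stalls (`2 → 2`) — the increase is a history effect. [cite: Hauser2010, §G] -/
theorem binomial_p2e2_control :
    shades 2 4 ⟨[([6, 2], 1)], [6, 0]⟩ [(0, [0, 1])] = [some 2, some 2] := by decide

/-- `x⁹ + y¹⁵z³` over `𝔽₃`, prescribed `r = (15, 1)`; chart `y`, point `z = 1`: shades `2, 3`. [cite: Hauser2010, §G] -/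
theorem binomial_p3e2_prescribed_kangaroo :
    shades 3 9 ⟨[([15, 3], 1)], [15, 1]⟩ [(0, [0, 1])] = [some 2, some 3] := by decide

end Literature.AlgebraicGeometry.Resolution.KangarooAtlasCert
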